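import Literature.Barriers.ValiantsHypothesis.GCTMatrixPoweringErratum
import Literature.Barriers.ValiantsHypothesis.GCTMatrixPoweringColumnSign
import Literature.Computability.Complexity.OccurrenceObstructionsIPHookPositivity
import Literature.NumberTheory.DiophantineGeometry.PartitionDominance
import HarnessLib

/-!
# Gesmundo–Ikenmeyer–Panova 2017, Prop. 19: a second ERRATUM (the printed row bound fails at
# `a = s² - 2`), the corrected Prop. 19 PROVED from the Kronecker semigroup and transposition
# properties, and the two-row positivity `g((n-2, 2), ν, ν) > 0` behind it

Sibling file (D-0014) of `GCTMatrixPoweringColumns.lean` (named fact `GIP2017_prop19`),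
`GCTMatrixPoweringErratum.lean` (first erratum: `(2,1³)` missing from Props. 18/20; the barrier
`GCTMatrixPowering` = GIP Thm. 10 reduced to `GIP2017_prop15 ∧ GIP2017_prop17 ∧
GIP2017_prop18_corrected ∧ GIP2017_prop19`) and `GCTMatrixPoweringSemigroup.lean`
(`GIP2017_prop15_holds`; (3.1) `g = sk + ak`: `skPos_or_akPos_of_kroneckerCoeff_pos`). Conventions as
there: `SmPos m λ` / `AmPos m λ` = "`sm(λ, m) > 0`" / "`am(λ, m) > 0`" through the character sums
`skCharSum`/`akCharSum`; `twoTwoCol a = (2,2,1^a)`; Kronecker coefficients are the tree's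
`kroneckerCoeff ℂ`.

**The erratum.** GIP Prop. 19 (arXiv:1611.00827 = Diff. Geom. Appl. 55 (2017), Prop. 3.6 of the
journal numbering): "We have that at least one of the two quantities is positive:
`sm((2,2,1^a), ℓ) > 0` or `am((2,2,1^a), ℓ) > 0`, where `ℓ = max{7, ⌈√(a+2)⌉}`", with the printed
proof "Let `μ` be a self-conjugate partition of `a + 4` and length at most `ℓ`, as constructed for
example in the proof of Proposition 17. Then Corollary 38 applies and `g(λ, μ, μ)` is strictly
positive". This is FALSE for `a = s² - 2`, `s ≥ 7` (`a = 47, 62, 79, 98, …`; then `ℓ = s`): by (3.1),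
`sm(λ, ℓ) + am(λ, ℓ) = Σ_{ℓ(μ) ≤ ℓ} g(λ, μ, μ)` for `λ = (2,2,1^a) ⊢ s² + 2`, and EVERY
`g((2,2,1^a), μ, μ) = g((s², 2), μᵗ, μ)` (transposition property) with `ℓ(μ) ≤ s` vanishes, by the
two-row rule `g((n-2,2), μ, ν) = Σ_{α ⊢ n-2, β ⊢ 2} c^μ_{αβ} c^ν_{αβ} - #{α ⊢ n-1 : α ⊂ μ ∩ ν}`
(`χ^{(n-2,2)} = 1↑_{𝔖_{n-2} × 𝔖_2} - 1↑_{𝔖_{n-1}}`, Frobenius reciprocity, Pieri): a common `α ⊢ s²`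
inside `μ ∩ μᵗ ⊂ s × s` forces `μ ⊇ s^s`, `μ/s^s` a domino and `μᵗ/s^s` the transposed domino, so
both sums are `0`. Concretely `sm((2,2,1^{47}), 7) = am((2,2,1^{47}), 7) = 0`. (Harness evidence of
the vendoring session, `evidence/prop19_check.py`, `evidence/prop19_scan.py`: the two-row rule
was validated against brute-force Murnaghan–Nakayama Kronecker coefficients for all
`μ, ν ⊢ n ≤ 9` (1804 pairs), and the scan over `a ≤ 64` found the printed bound failing exactly at
`a ∈ {47, 62}` and the bound `ℓ + 1` always satisfiable.) The gap in print: Prop. 17 constructs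
self-conjugate partitions of `a` (not `a + 4`) of length `≤ ⌊√a⌋ + 2` (not `⌈√(a+2)⌉`); a
self-conjugate `μ ⊢ a + 4` of length `≤ s` needs `a + 4 ≤ s²`. GIP's Prop. 20 only invokes Prop. 19
with `ℓ = max{⌈√L⌉ + 2, 12} ≥ ⌈√(a+2)⌉ + 2`, so one more row costs nothing downstream. The
vendored `GIP2017_prop19` (all `a`, printed `ℓ`) is therefore unprovable, and the reduction
`gctMatrixPowering_of_parts_corrected` of the Erratum file has an unsatisfiable hypothesis; the
sibling assembly file re-threads Thm. 10 through the corrected statement below.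

**What this file proves** (everything; no `sorry`; one new `def … : Prop`, WITH its proof):

1. Partition bookkeeping: rows of `μᵗ` are the column counts of the parts of `μ`
   (`getD_sortedParts_transpose_eq_colCount`), the self-conjugacy criterion
   `transpose_eq_self_of_rows`, `(μᵗ + νᵗ)ᵗ = μ ⊔ ν` (`transpose_rowAdd_transpose`, with the tree's
   `Nat.Partition.rowAdd`/`Nat.Partition.append`), `(M)ᵗ = (1^M)`, the two-row shape
   `rowTwo a = (a+2, 2) = (2,2,1^a)ᵗ`, the pair `rowPair p q = (p, q)`.
2. Closure moves for positive Kronecker triples, from the tree's PROVED semigroup property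
   (`ikenmeyerPanova2017_semigroup_holds`, Christandl–Harrow–Mitchison / IP §1.1), transposition
   property (`kroneckerCoeff_transpose`, `…₁₂`, `…₁₃`), `S₃`-symmetry and `g((n), γ, γ) > 0`
   (`kroneckerCoeff_indiscrete_pos`): row-wise sum in one argument and union of parts in the
   other two (`kroneckerCoeff_pos_rowAdd_append`), the atoms `((1^M), (M), (1^M))`,
   `((1^M), (1^M), (M))`, the base triple `((p+q-2, 2), (p,q), (p,q))` for `p ≥ q + 2 ≥ 3`
   (`kroneckerCoeff_pos_rowTwo_rowPair`: `((1,1),(2),(1,1)) + ((1,1),(1,1),(2)) +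
   ((p+q-4),(p-3,q-1),(p-3,q-1))`).
3. **Two-row positivity** (`kroneckerCoeff_rowTwo_pos_of_parts`): if `ν ⊢ a + 4` has two parts
   `p ≥ q + 2 ≥ 3` then `g((a+2, 2), ν, ν) > 0` — a Durfee-size-free sufficient condition in the
   role of GIP Prop. 37 (`b = 2`); for self-conjugate `ν`, `g((2,2,1^a), ν, ν) > 0`
   (`kroneckerCoeff_twoTwoCol_pos_of_parts`, the role of Cor. 38) and hence
   `sm((2,2,1^a), ℓ(ν)) > 0 ∨ am((2,2,1^a), ℓ(ν)) > 0` (`smPos_or_amPos_twoTwoCol_of_parts`).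
4. Block partitions `blocks k₁ c₁ … k₅ c₅` (parts `c₁^{k₁} ⋯ c₅^{k₅}`) with their rows, column
   counts, and the arithmetic self-conjugacy test `blocks_transpose_eq_self`.
5. **`GIP2017_prop19_corrected`** — Prop. 19 with `ℓ = max{7, ⌈√(a+2)⌉ + 1}` — and its proof
   `GIP2017_prop19_corrected_holds`: for every `a`, a self-conjugate `ν ⊢ a + 4` with two rows
   differing by `≥ 2` and `ℓ(ν) ≤ max{7, ⌊√(a+1)⌋ + 2}` (seven explicit block families indexed by
   `s = ⌊√(a+1)⌋` and the parity of `a + 4 - s²`; `(3,1)` for `a = 0`, `(5,1⁴)` for `a = 5`).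

## References

* [GesmundoIkenmeyerPanova2017] F. Gesmundo, C. Ikenmeyer, G. Panova, *Geometric complexity theory
  and matrix powering*, Diff. Geom. Appl. 55 (2017) 106–127 = arXiv:1611.00827: §3 ((3.1),
  Prop. 19, Prop. 20 and its proof), §8 (Prop. 37, Cor. 38 and their proofs by the semigroup and
  transposition properties).
* [IkenmeyerPanova2017] C. Ikenmeyer, G. Panova, *Rectangular Kronecker coefficients and plethysms
  in geometric complexity theory*, Adv. Math. 319 (2017), §1.1 (semigroup and transposition
  properties of Kronecker coefficients).
* [FultonYoungTableaux1997] W. Fulton, *Young Tableaux* (1997), §0 (conjugate partition).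
-/

noncomputable section

open scoped BigOperators

namespace Literature.Barriers.ValiantsHypothesis

open Literature.NumberTheory.DiophantineGeometry Literature.Computability.Complexity Finset

/-! ### 1. Partition lemmas: transpose versus `colCount`, `(μᵗ + νᵗ)ᵗ = μ ⊔ ν` -/

section Partitions

variable {n : ℕ}

/-- The rows of `μᵗ` are the column counts of the parts of `μ`: `μᵗ_{r+1} = #{i : μ_i > r}`.
[cite: FultonYoungTableaux1997, §0 (conjugate partition)] -/
theorem getD_sortedParts_transpose_eq_colCount (μ : Nat.Partition n) (r : ℕ) :
    μ.transpose.sortedParts.getD r 0 = colCount μ.parts r := by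
  rw [getD_sortedParts_eq_colCount_transpose, Nat.Partition.transpose_transpose]

/-- Transposition of partitions is injective. [folklore] -/
theorem eq_of_transpose_eq {μ ν : Nat.Partition n} (h : μ.transpose = ν.transpose) : μ = ν := by
  rw [← Nat.Partition.transpose_transpose μ, h, Nat.Partition.transpose_transpose]

/-- **Self-conjugacy criterion**: `μ = μᵗ` as soon as the rows of `μ` are the column counts of its
own parts, `μ_{r+1} = #{i : μ_i > r}` for all `r`. [cite: FultonYoungTableaux1997, §0 (conjugate partition)] -/
theorem transpose_eq_self_of_rows (μ : Nat.Partition n)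
    (h : ∀ r, μ.sortedParts.getD r 0 = colCount μ.parts r) : μ.transpose = μ :=
  Nat.Partition.ext (Literature.Computability.Complexity.parts_eq_of_getD_sortedParts_eq fun r => by
    rw [getD_sortedParts_transpose_eq_colCount, h])

/-- **`(μᵗ + νᵗ)ᵗ = μ ⊔ ν`**: the transpose of the row-wise sum of the transposes is the partition
with the parts of `μ` and of `ν` together (row-wise sum = union of columns).
[cite: GesmundoIkenmeyerPanova2017, §2.1 (definition of λ+μ)] -/
theorem transpose_rowAdd_transpose {a b : ℕ} (μ : Nat.Partition a) (ν : Nat.Partition b) :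
    (μ.transpose.rowAdd ν.transpose).transpose = μ.append ν rfl := by
  apply eq_of_transpose_eq
  rw [Nat.Partition.transpose_transpose]
  refine Nat.Partition.ext (Literature.Computability.Complexity.parts_eq_of_getD_sortedParts_eq fun r => ?_)
  rw [getD_sortedParts_rowAdd, getD_sortedParts_transpose_eq_colCount,
    getD_sortedParts_transpose_eq_colCount, getD_sortedParts_transpose_eq_colCount,
    Nat.Partition.parts_append, colCount_add]

/-- `(M)ᵗ = (1^M)`. [folklore] -/
theorem transpose_indiscrete (M : ℕ) :
    (Nat.Partition.indiscrete M).transpose = Nat.Partition.column M :=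
  Nat.Partition.ext (Literature.Computability.Complexity.parts_eq_of_getD_sortedParts_eq fun r => by
    rw [getD_sortedParts_indiscrete_transpose, getD_sortedParts_column, colCount_singleton])

/-- **The two-row shape `(a+2, 2) = (2,2,1^a)ᵗ`** (GIP Cor. 38: "`(1^a + 1^b)^t = (a, b)`").
[cite: GesmundoIkenmeyerPanova2017, Cor. 38] -/
def rowTwo (a : ℕ) : Nat.Partition (a + 4) :=
  (twoTwoCol a).transpose

/-- The rows of `(a+2, 2)`. [folklore] -/
theorem getD_sortedParts_rowTwo (a r : ℕ) :
    (rowTwo a).sortedParts.getD r 0 = if r = 0 then a + 2 else if r = 1 then 2 else 0 := by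
  rw [rowTwo, getD_sortedParts_transpose_eq_colCount, twoTwoCol_parts, colCount_cons,
    colCount_cons, colCount_replicate]
  split_ifs <;> omega

/-- `(2,2)ᵗ = (2,2)`. [folklore] -/
theorem rowTwo_zero : rowTwo 0 = twoTwoCol 0 :=
  Nat.Partition.ext (Literature.Computability.Complexity.parts_eq_of_getD_sortedParts_eq fun r => by
    rw [getD_sortedParts_rowTwo, sortedParts_twoTwoCol]
    rcases r with _ | _ | r <;> simp)

/-- The partition `(p, q)` with the two parts `p`, `q` (zero parts dropped), written in size `N`.
[folklore] -/
def rowPair (p q : ℕ) {N : ℕ} (h : p + q = N) : Nat.Partition N :=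
  (Nat.Partition.indiscrete p).append (Nat.Partition.indiscrete q) h

/-- The parts of `(p, q)` for `p, q ≥ 1`. [folklore] -/
theorem rowPair_parts {p q N : ℕ} (h : p + q = N) (hp : p ≠ 0) (hq : q ≠ 0) :
    (rowPair p q h).parts = {p, q} := by
  rw [rowPair, Nat.Partition.parts_append, Nat.Partition.indiscrete_parts hp,
    Nat.Partition.indiscrete_parts hq, Multiset.insert_eq_cons, Multiset.singleton_add]

/-- The rows of `(p, q)` for `p ≥ q ≥ 1`. [folklore] -/
theorem getD_sortedParts_rowPair {p q N : ℕ} (h : p + q = N) (hpq : q ≤ p) (hq : 1 ≤ q) (r : ℕ) :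
    (rowPair p q h).sortedParts.getD r 0 = if r = 0 then p else if r = 1 then q else 0 := by
  have hs : (rowPair p q h).sortedParts = [p, q] := by
    change (rowPair p q h).parts.sort (· ≥ ·) = _
    rw [rowPair_parts h (by omega) (by omega), Multiset.insert_eq_cons, ← Multiset.singleton_add,
      ← Multiset.coe_singleton p, ← Multiset.coe_singleton q, Multiset.coe_add, Multiset.coe_sort]
    exact List.mergeSort_eq_self _ (by simp [hpq])
  rw [hs]
  rcases r with _ | _ | r <;> simp

end Partitions

/-! ### 2. Positive Kronecker triples: the closure moves and the atoms -/

section Kronecker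

/-- **Row-wise sum in the first argument, union of parts in the other two**: if `g(λ, μ, ν) > 0`
and `g(λ', μ', ν') > 0` then `g(λ + λ', μ ⊔ μ', ν ⊔ ν') > 0` — the semigroup property applied to
the transposed triples `g(λ, μᵗ, νᵗ)`, `g(λ', μ'ᵗ, ν'ᵗ)` and transposed back (GIP, proof of Prop. 37:
"Since the Kronecker is invariant under transposition of two partitions we also have ...").
[cite: GesmundoIkenmeyerPanova2017, Prop. 37 (proof)] -/
theorem kroneckerCoeff_pos_rowAdd_append {a b : ℕ} {lam mu nu : Nat.Partition a}
    {lam' mu' nu' : Nat.Partition b} (h : 0 < kroneckerCoeff ℂ lam mu nu)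
    (h' : 0 < kroneckerCoeff ℂ lam' mu' nu') :
    0 < kroneckerCoeff ℂ (lam.rowAdd lam') (mu.append mu' rfl) (nu.append nu' rfl) := by
  rw [kroneckerCoeff_transpose ℂ] at h h'
  have hs := ikenmeyerPanova2017_semigroup_holds _ _ _ _ _ _ h h'
  rwa [kroneckerCoeff_transpose ℂ, transpose_rowAdd_transpose, transpose_rowAdd_transpose] at hs

/-- The atom `g((1^M), (M), (1^M)) > 0` (`= g((M), (M), (M)) = 1` transposed in two arguments).
[cite: GesmundoIkenmeyerPanova2017, Prop. 37 (proof: "g((|α|), α, α) = 1 > 0")] -/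
theorem kroneckerCoeff_pos_column_indiscrete_column (M : ℕ) :
    0 < kroneckerCoeff ℂ (Nat.Partition.column M) (Nat.Partition.indiscrete M)
      (Nat.Partition.column M) := by
  have h := kroneckerCoeff_indiscrete_pos ℂ (Nat.Partition.indiscrete M)
  rwa [kroneckerCoeff_transpose₁₃ ℂ, transpose_indiscrete] at h

/-- The atom `g((1^M), (1^M), (M)) > 0`. [cite: GesmundoIkenmeyerPanova2017, Prop. 37 (proof)] -/
theorem kroneckerCoeff_pos_column_column_indiscrete (M : ℕ) :
    0 < kroneckerCoeff ℂ (Nat.Partition.column M) (Nat.Partition.column M)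
      (Nat.Partition.indiscrete M) := by
  rw [kroneckerCoeff_comm₂₃_holds ℂ]
  exact kroneckerCoeff_pos_column_indiscrete_column M

/-- **The base triple `g((p+q-2, 2), (p, q), (p, q)) > 0` for `p ≥ q + 2`, `q ≥ 1`** (written
`q = y + 1`, `p = y + v + 3`): the row-wise sum of the positive triples `((1,1), (2), (1,1))`,
`((1,1), (1,1), (2))` and `((2y+v), (y+v, y), (y+v, y))`. [cite: GesmundoIkenmeyerPanova2017, Prop. 37 (proof: semigroup property)] -/
theorem kroneckerCoeff_pos_rowTwo_rowPair (y v : ℕ) (h : y + v + 3 + (y + 1) = y + v + y + 4) :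
    0 < kroneckerCoeff ℂ (rowTwo (y + v + y)) (rowPair (y + v + 3) (y + 1) h)
      (rowPair (y + v + 3) (y + 1) h) := by
  -- the third atom: `g((2y+v), γ, γ)`, `γ = (y+v, y) = (v) + (y, y)`
  set γ : Nat.Partition (v + 2 * y) :=
    (Nat.Partition.indiscrete v).rowAdd (Nat.Partition.rectangle 2 y) with hγ
  have hγr : ∀ r, γ.sortedParts.getD r 0 = (if r = 0 then v else 0) + if r < 2 then y else 0 :=
    fun r => by rw [hγ, getD_sortedParts_rowAdd, getD_sortedParts_indiscrete,
      getD_sortedParts_rectangle]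
  have h3 := kroneckerCoeff_indiscrete_pos ℂ γ
  have h12 := ikenmeyerPanova2017_semigroup_holds _ _ _ _ _ _
    (kroneckerCoeff_pos_column_indiscrete_column 2) (kroneckerCoeff_pos_column_column_indiscrete 2)
  have h123 := ikenmeyerPanova2017_semigroup_holds _ _ _ _ _ _ h12 h3
  have hsz : 2 + 2 + (v + 2 * y) = y + v + y + 4 := by ring
  have hcol : ∀ r, (Nat.Partition.column 2).sortedParts.getD r 0 = if r < 2 then 1 else 0 :=
    fun r => by rw [getD_sortedParts_column, colCount_singleton]
  rw [kroneckerCoeff_congr_parts hsz (lam' := rowTwo (y + v + y))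
    (mu' := rowPair (y + v + 3) (y + 1) h) (nu' := rowPair (y + v + 3) (y + 1) h)] at h123
  · exact h123
  · refine Literature.Computability.Complexity.parts_eq_of_getD_sortedParts_eq fun r => ?_
    rw [getD_sortedParts_rowAdd, getD_sortedParts_rowAdd, hcol, getD_sortedParts_indiscrete,
      getD_sortedParts_rowTwo]
    split_ifs <;> omega
  · refine Literature.Computability.Complexity.parts_eq_of_getD_sortedParts_eq fun r => ?_
    rw [getD_sortedParts_rowAdd, getD_sortedParts_rowAdd, hcol, getD_sortedParts_indiscrete, hγr,
      getD_sortedParts_rowPair h (by omega) (by omega)]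
    split_ifs <;> omega
  · refine Literature.Computability.Complexity.parts_eq_of_getD_sortedParts_eq fun r => ?_
    rw [getD_sortedParts_rowAdd, getD_sortedParts_rowAdd, hcol, getD_sortedParts_indiscrete, hγr,
      getD_sortedParts_rowPair h (by omega) (by omega)]
    split_ifs <;> omega

/-- **Two rows differing by at least two force `g((n-2, 2), ν, ν) > 0`**: if `ν ⊢ a + 4` has two
parts `p ≥ q + 2 ≥ 3` (written `q = y + 1`, `p = y + v + 3`; the remaining parts `β` arbitrary),
then `g((a+2, 2), ν, ν) > 0` — the base triple `((p+q-2, 2), (p,q), (p,q))` plus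
`((|β|), β, β)`, the latter two arguments by union of parts. A sufficient condition for the
positivity in GIP's Prop. 37 with `b = 2` that needs no lower bound on the Durfee size.
[cite: GesmundoIkenmeyerPanova2017, Prop. 37 (b = 2)] -/
theorem kroneckerCoeff_rowTwo_pos_of_parts {a : ℕ} (nu : Nat.Partition (a + 4)) {y v : ℕ}
    {β : Multiset ℕ} (hν : nu.parts = (y + v + 3) ::ₘ (y + 1) ::ₘ β) :
    0 < kroneckerCoeff ℂ (rowTwo a) nu nu := by
  have hβpos : ∀ c ∈ β, 0 < c := fun c hc =>
    nu.parts_pos (by rw [hν]; exact Multiset.mem_cons_of_mem (Multiset.mem_cons_of_mem hc))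
  set b := β.sum with hb
  let βp : Nat.Partition b := ⟨β, fun hc => hβpos _ hc, rfl⟩
  have hsum : y + v + 3 + (y + 1) + b = a + 4 := by
    have := nu.parts_sum
    rw [hν, Multiset.sum_cons, Multiset.sum_cons] at this
    omega
  have hB := kroneckerCoeff_pos_rowTwo_rowPair y v (by omega)
  have hT := kroneckerCoeff_indiscrete_pos ℂ βp
  have hBT := kroneckerCoeff_pos_rowAdd_append hB hT
  have hsz : y + v + y + 4 + b = a + 4 := by omega
  rw [kroneckerCoeff_congr_parts hsz (lam' := rowTwo a) (mu' := nu) (nu' := nu)] at hBT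
  · exact hBT
  · refine Literature.Computability.Complexity.parts_eq_of_getD_sortedParts_eq fun r => ?_
    rw [getD_sortedParts_rowAdd, getD_sortedParts_rowTwo, getD_sortedParts_rowTwo,
      getD_sortedParts_indiscrete]
    split_ifs <;> omega
  · rw [Nat.Partition.parts_append, rowPair_parts _ (by omega) (by omega), hν,
      Multiset.insert_eq_cons, Multiset.cons_add, Multiset.singleton_add]
  · rw [Nat.Partition.parts_append, rowPair_parts _ (by omega) (by omega), hν,
      Multiset.insert_eq_cons, Multiset.cons_add, Multiset.singleton_add]

/-- **Self-conjugate `ν` with two rows differing by at least two: `g((2,2,1^a), ν, ν) > 0`**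
(`g((2,2,1^a), ν, ν) = g((a+2,2), νᵗ, ν)`, transposition in two arguments; GIP Cor. 38 with
`b = 2`, the Durfee-size hypothesis replaced by the row-gap hypothesis).
[cite: GesmundoIkenmeyerPanova2017, Cor. 38 (b = 2)] -/
theorem kroneckerCoeff_twoTwoCol_pos_of_parts {a : ℕ} (nu : Nat.Partition (a + 4))
    (hself : nu.transpose = nu) {y v : ℕ} {β : Multiset ℕ}
    (hν : nu.parts = (y + v + 3) ::ₘ (y + 1) ::ₘ β) :
    0 < kroneckerCoeff ℂ (twoTwoCol a) nu nu := by
  rw [kroneckerCoeff_transpose₁₂ ℂ, hself]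
  exact kroneckerCoeff_rowTwo_pos_of_parts nu hν

/-- **Corrected engine of GIP Prop. 19**: a self-conjugate `ν ⊢ a + 4` with two rows differing by
at least two gives `sm((2,2,1^a), ℓ(ν)) > 0` or `am((2,2,1^a), ℓ(ν)) > 0` (via (3.1):
`g = sk + ak`). [cite: GesmundoIkenmeyerPanova2017, Prop. 19 (proof)] -/
theorem smPos_or_amPos_twoTwoCol_of_parts {a : ℕ} (nu : Nat.Partition (a + 4))
    (hself : nu.transpose = nu) {y v : ℕ} {β : Multiset ℕ}
    (hν : nu.parts = (y + v + 3) ::ₘ (y + 1) ::ₘ β) {ℓ : ℕ} (hℓ : nu.parts.card ≤ ℓ) :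
    SmPos ℓ (twoTwoCol a) ∨ AmPos ℓ (twoTwoCol a) := by
  rcases skPos_or_akPos_of_kroneckerCoeff_pos _ _
    (kroneckerCoeff_twoTwoCol_pos_of_parts nu hself hν) with h | h
  · exact Or.inl ⟨nu, hℓ, h⟩
  · exact Or.inr ⟨nu, hℓ, h⟩

/-- The case `a = 0` of Prop. 19: `g((2,2), (3,1), (3,1)) > 0` (the base triple with `p = 3`,
`q = 1`), so `sm((2,2), 2) > 0` or `am((2,2), 2) > 0`. [cite: GesmundoIkenmeyerPanova2017, Prop. 19 (a = 0)] -/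
theorem smPos_or_amPos_twoTwoCol_zero {ℓ : ℕ} (hℓ : 2 ≤ ℓ) :
    SmPos ℓ (twoTwoCol 0) ∨ AmPos ℓ (twoTwoCol 0) := by
  have h := kroneckerCoeff_rowTwo_pos_of_parts (a := 0) (rowPair 3 1 rfl) (y := 0) (v := 0)
    (β := 0) (by rw [rowPair_parts _ (by norm_num) (by norm_num)]; rfl)
  rw [rowTwo_zero] at h
  have hcard : (rowPair 3 1 (rfl : 3 + 1 = 0 + 4)).parts.card = 2 := by
    rw [rowPair_parts _ (by norm_num) (by norm_num)]; rfl
  rcases skPos_or_akPos_of_kroneckerCoeff_pos _ _ h with h | h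
  · exact Or.inl ⟨_, hcard.le.trans hℓ, h⟩
  · exact Or.inr ⟨_, hcard.le.trans hℓ, h⟩

end Kronecker

/-! ### 3. Self-conjugate witnesses: partitions with five blocks of equal parts -/

section Blocks

/-- `(rep k c ++ l).getD r 0`. [folklore] -/
theorem getD_replicate_append (k c : ℕ) (l : List ℕ) (r : ℕ) :
    (List.replicate k c ++ l).getD r 0 = if r < k then c else l.getD (r - k) 0 := by
  split_ifs with h
  · rw [List.getD_append _ _ _ _ (by simpa using h), List.getD_eq_getElem _ _ (by simpa using h),
      List.getElem_replicate]
  · rw [List.getD_append_right _ _ _ _ (by simpa using not_lt.mp h), List.length_replicate]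

/-- A decreasing list stays decreasing when a block of larger equal entries is put in front.
[folklore] -/
theorem pairwise_ge_replicate_append {c : ℕ} {l : List ℕ} (hl : l.Pairwise (· ≥ ·))
    (hc : ∀ b ∈ l, b ≤ c) (k : ℕ) : (List.replicate k c ++ l).Pairwise (· ≥ ·) := by
  rw [List.pairwise_append]
  refine ⟨List.pairwise_replicate.mpr (Or.inr le_rfl), hl, fun a ha b hb => ?_⟩
  rw [(List.mem_replicate.mp ha).2]
  exact hc b hb

/-- The list `c₁^{k₁} c₂^{k₂} c₃^{k₃} c₄^{k₄} c₅^{k₅}` (blocks of equal entries). [folklore] -/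
def blockList (k₁ c₁ k₂ c₂ k₃ c₃ k₄ c₄ k₅ c₅ : ℕ) : List ℕ :=
  List.replicate k₁ c₁ ++ (List.replicate k₂ c₂ ++ (List.replicate k₃ c₃ ++
    (List.replicate k₄ c₄ ++ List.replicate k₅ c₅)))

variable {k₁ c₁ k₂ c₂ k₃ c₃ k₄ c₄ k₅ c₅ : ℕ}

/-- Membership in a block list. [folklore] -/
theorem mem_blockList {x : ℕ} :
    x ∈ blockList k₁ c₁ k₂ c₂ k₃ c₃ k₄ c₄ k₅ c₅ ↔
      (k₁ ≠ 0 ∧ x = c₁) ∨ (k₂ ≠ 0 ∧ x = c₂) ∨ (k₃ ≠ 0 ∧ x = c₃) ∨ (k₄ ≠ 0 ∧ x = c₄) ∨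
        (k₅ ≠ 0 ∧ x = c₅) := by
  simp only [blockList, List.mem_append, List.mem_replicate]

/-- A block list with weakly decreasing block values is decreasing. [folklore] -/
theorem pairwise_blockList (hc : c₂ ≤ c₁ ∧ c₃ ≤ c₂ ∧ c₄ ≤ c₃ ∧ c₅ ≤ c₄) :
    (blockList k₁ c₁ k₂ c₂ k₃ c₃ k₄ c₄ k₅ c₅).Pairwise (· ≥ ·) := by
  obtain ⟨h₁, h₂, h₃, h₄⟩ := hc
  refine pairwise_ge_replicate_append (pairwise_ge_replicate_append
    (pairwise_ge_replicate_append (pairwise_ge_replicate_append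
      (List.pairwise_replicate.mpr (Or.inr le_rfl)) ?_ _) ?_ _) ?_ _) ?_ _
  · intro b hb
    rw [(List.mem_replicate.mp hb).2]
    exact h₄
  · intro b hb
    simp only [List.mem_append, List.mem_replicate] at hb
    omega
  · intro b hb
    simp only [List.mem_append, List.mem_replicate] at hb
    omega
  · intro b hb
    simp only [List.mem_append, List.mem_replicate] at hb
    omega

/-- The entries of a block list. [folklore] -/
theorem getD_blockList (r : ℕ) :
    (blockList k₁ c₁ k₂ c₂ k₃ c₃ k₄ c₄ k₅ c₅).getD r 0 =
      if r < k₁ then c₁ else if r < k₁ + k₂ then c₂ else if r < k₁ + k₂ + k₃ then c₃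
        else if r < k₁ + k₂ + k₃ + k₄ then c₄ else if r < k₁ + k₂ + k₃ + k₄ + k₅ then c₅
          else 0 := by
  simp only [blockList, getD_replicate_append]
  have h5 : ∀ i, (List.replicate k₅ c₅).getD i 0 = if i < k₅ then c₅ else 0 := fun i => by
    rw [← List.append_nil (List.replicate k₅ c₅), getD_replicate_append, List.getD_nil]
  rw [h5]
  split_ifs <;> omega

/-- **The partition with parts `c₁^{k₁} c₂^{k₂} c₃^{k₃} c₄^{k₄} c₅^{k₅}`** (five blocks of equal
parts, `c₁ ≥ ⋯ ≥ c₅ ≥ 1`, empty blocks allowed), written in size `N`: the shape of the explicit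
self-conjugate partitions of GIP's Prop. 17 / Prop. 19 proofs. [cite: GesmundoIkenmeyerPanova2017, Prop. 17 (proof: the partitions α, β, γ, δ)] -/
def blocks (k₁ c₁ k₂ c₂ k₃ c₃ k₄ c₄ k₅ c₅ : ℕ) {N : ℕ}
    (hc : c₂ ≤ c₁ ∧ c₃ ≤ c₂ ∧ c₄ ≤ c₃ ∧ c₅ ≤ c₄ ∧ 1 ≤ c₅)
    (h : k₁ * c₁ + k₂ * c₂ + k₃ * c₃ + k₄ * c₄ + k₅ * c₅ = N) : Nat.Partition N where
  parts := (blockList k₁ c₁ k₂ c₂ k₃ c₃ k₄ c₄ k₅ c₅ : Multiset ℕ)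
  parts_pos hi := by
    rw [Multiset.mem_coe, mem_blockList] at hi
    omega
  parts_sum := by
    rw [Multiset.sum_coe, blockList]
    simp only [List.sum_append, List.sum_replicate, smul_eq_mul]
    omega

variable {N : ℕ} (hc : c₂ ≤ c₁ ∧ c₃ ≤ c₂ ∧ c₄ ≤ c₃ ∧ c₅ ≤ c₄ ∧ 1 ≤ c₅)
  (h : k₁ * c₁ + k₂ * c₂ + k₃ * c₃ + k₄ * c₄ + k₅ * c₅ = N)

/-- The parts of a block partition. [folklore] -/
theorem blocks_parts : (blocks k₁ c₁ k₂ c₂ k₃ c₃ k₄ c₄ k₅ c₅ hc h).parts =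
    (blockList k₁ c₁ k₂ c₂ k₃ c₃ k₄ c₄ k₅ c₅ : Multiset ℕ) :=
  rfl

/-- The sorted parts of a block partition are its block list. [folklore] -/
theorem sortedParts_blocks : (blocks k₁ c₁ k₂ c₂ k₃ c₃ k₄ c₄ k₅ c₅ hc h).sortedParts =
    blockList k₁ c₁ k₂ c₂ k₃ c₃ k₄ c₄ k₅ c₅ := by
  change (blocks k₁ c₁ k₂ c₂ k₃ c₃ k₄ c₄ k₅ c₅ hc h).parts.sort (· ≥ ·) = _
  rw [blocks_parts, Multiset.coe_sort]
  exact List.mergeSort_eq_self _ (pairwise_blockList ⟨hc.1, hc.2.1, hc.2.2.1, hc.2.2.2.1⟩)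

/-- The rows of a block partition. [folklore] -/
theorem getD_sortedParts_blocks (r : ℕ) :
    (blocks k₁ c₁ k₂ c₂ k₃ c₃ k₄ c₄ k₅ c₅ hc h).sortedParts.getD r 0 =
      if r < k₁ then c₁ else if r < k₁ + k₂ then c₂ else if r < k₁ + k₂ + k₃ then c₃
        else if r < k₁ + k₂ + k₃ + k₄ then c₄ else if r < k₁ + k₂ + k₃ + k₄ + k₅ then c₅
          else 0 := by
  rw [sortedParts_blocks, getD_blockList]

/-- The column counts of a block partition. [folklore] -/
theorem colCount_blocks_parts (r : ℕ) :
    colCount (blocks k₁ c₁ k₂ c₂ k₃ c₃ k₄ c₄ k₅ c₅ hc h).parts r =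
      (if r < c₁ then k₁ else 0) + (if r < c₂ then k₂ else 0) + (if r < c₃ then k₃ else 0) +
        (if r < c₄ then k₄ else 0) + (if r < c₅ then k₅ else 0) := by
  rw [blocks_parts, blockList]
  simp only [← Multiset.coe_add, Multiset.coe_replicate, colCount_add, colCount_replicate]
  ac_rfl

/-- The number of parts of a block partition. [folklore] -/
theorem card_blocks_parts :
    (blocks k₁ c₁ k₂ c₂ k₃ c₃ k₄ c₄ k₅ c₅ hc h).parts.card = k₁ + k₂ + k₃ + k₄ + k₅ := by
  rw [blocks_parts, Multiset.coe_card, blockList]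
  simp only [List.length_append, List.length_replicate]
  ring

/-- Membership of the block values. [folklore] -/
theorem mem_blocks_parts {x : ℕ}
    (hx : (k₁ ≠ 0 ∧ x = c₁) ∨ (k₂ ≠ 0 ∧ x = c₂) ∨ (k₃ ≠ 0 ∧ x = c₃) ∨ (k₄ ≠ 0 ∧ x = c₄) ∨
      (k₅ ≠ 0 ∧ x = c₅)) :
    x ∈ (blocks k₁ c₁ k₂ c₂ k₃ c₃ k₄ c₄ k₅ c₅ hc h).parts := by
  rw [blocks_parts, Multiset.mem_coe, mem_blockList]
  exact hx

/-- **Self-conjugacy of a block partition** reduces to the arithmetic identity "row `r` =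
number of parts exceeding `r`". [cite: FultonYoungTableaux1997, §0 (conjugate partition)] -/
theorem blocks_transpose_eq_self
    (hrows : ∀ r : ℕ, (if r < k₁ then c₁ else if r < k₁ + k₂ then c₂ else if r < k₁ + k₂ + k₃ then c₃
        else if r < k₁ + k₂ + k₃ + k₄ then c₄ else if r < k₁ + k₂ + k₃ + k₄ + k₅ then c₅ else 0) =
      (if r < c₁ then k₁ else 0) + (if r < c₂ then k₂ else 0) + (if r < c₃ then k₃ else 0) +
        (if r < c₄ then k₄ else 0) + (if r < c₅ then k₅ else 0)) :
    (blocks k₁ c₁ k₂ c₂ k₃ c₃ k₄ c₄ k₅ c₅ hc h).transpose = blocks k₁ c₁ k₂ c₂ k₃ c₃ k₄ c₄ k₅ c₅ hc h :=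
  transpose_eq_self_of_rows _ fun r => by
    rw [getD_sortedParts_blocks, colCount_blocks_parts, hrows]

end Blocks

/-! ### 4. GIP Prop. 19, corrected: the witnesses and the assembly -/

section Prop19

/-- Two parts `p ≥ q + 2 ≥ 3` can be split off: `ν.parts = p :: q :: β`. [folklore] -/
theorem exists_parts_eq_cons_cons {n : ℕ} (nu : Nat.Partition n) {p q : ℕ} (hp : p ∈ nu.parts)
    (hq : q ∈ nu.parts) (hne : q ≠ p) : ∃ β : Multiset ℕ, nu.parts = p ::ₘ q ::ₘ β :=
  ⟨(nu.parts.erase p).erase q, by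
    rw [Multiset.cons_erase ((Multiset.mem_erase_of_ne hne).mpr hq), Multiset.cons_erase hp]⟩

/-- The engine with the two rows given by membership: a self-conjugate `ν ⊢ a + 4` with parts
`p ≥ q + 2 ≥ 3` and at most `ℓ` parts gives `sm((2,2,1^a), ℓ) > 0` or `am((2,2,1^a), ℓ) > 0`.
[cite: GesmundoIkenmeyerPanova2017, Prop. 19 (proof)] -/
theorem smPos_or_amPos_twoTwoCol_of_mem {a : ℕ} (nu : Nat.Partition (a + 4))
    (hself : nu.transpose = nu) {p q : ℕ} (hp : p ∈ nu.parts) (hq : q ∈ nu.parts) (hq1 : 1 ≤ q)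
    (hpq : q + 2 ≤ p) {ℓ : ℕ} (hℓ : nu.parts.card ≤ ℓ) :
    SmPos ℓ (twoTwoCol a) ∨ AmPos ℓ (twoTwoCol a) := by
  obtain ⟨β, hβ⟩ := exists_parts_eq_cons_cons nu hp hq (by omega)
  obtain ⟨y, rfl⟩ : ∃ y, q = y + 1 := ⟨q - 1, by omega⟩
  obtain ⟨v, rfl⟩ : ∃ v, p = y + v + 3 := ⟨p - y - 3, by omega⟩
  exact smPos_or_amPos_twoTwoCol_of_parts nu hself hβ hℓ

/-- Witness `(m+1, m^{m-1}, 1) ⊢ m² + 2` (`m = t + 2`; self-conjugate, rows `m + 1 > 1`, `m + 1`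
parts). [cite: GesmundoIkenmeyerPanova2017, Prop. 19 (proof: self-conjugate μ ⊢ a+4)] -/
theorem prop19_witness₁ (t a : ℕ) (ha : a + 4 = (t + 2) * (t + 2) + 2) {ℓ : ℕ} (hℓ : t + 3 ≤ ℓ) :
    SmPos ℓ (twoTwoCol a) ∨ AmPos ℓ (twoTwoCol a) := by
  have hm : (t + 1) * (t + 2) = t * t + 3 * t + 2 := by ring
  have hm' : (t + 2) * (t + 2) = t * t + 4 * t + 4 := by ring
  let nu : Nat.Partition (a + 4) :=
    blocks 1 (t + 3) (t + 1) (t + 2) 0 1 0 1 1 1 (by omega) (by omega)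
  refine smPos_or_amPos_twoTwoCol_of_mem nu (blocks_transpose_eq_self _ _ fun r => ?_)
    (p := t + 3) (q := 1) (mem_blocks_parts _ _ (by omega)) (mem_blocks_parts _ _ (by omega))
    le_rfl (by omega) (by rw [card_blocks_parts]; omega)
  split_ifs <;> omega

/-- Witness `(m+1, m^{m-2}, m-1, 1) ⊢ m² + 1` (`m = t + 2`). [cite: GesmundoIkenmeyerPanova2017, Prop. 19 (proof)] -/
theorem prop19_witness₂ (t a : ℕ) (ha : a + 4 = (t + 2) * (t + 2) + 1) {ℓ : ℕ} (hℓ : t + 3 ≤ ℓ) :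
    SmPos ℓ (twoTwoCol a) ∨ AmPos ℓ (twoTwoCol a) := by
  have hm : t * (t + 2) = t * t + 2 * t := by ring
  have hm' : (t + 2) * (t + 2) = t * t + 4 * t + 4 := by ring
  let nu : Nat.Partition (a + 4) :=
    blocks 1 (t + 3) t (t + 2) 1 (t + 1) 0 1 1 1 (by omega) (by omega)
  refine smPos_or_amPos_twoTwoCol_of_mem nu (blocks_transpose_eq_self _ _ fun r => ?_)
    (p := t + 3) (q := 1) (mem_blocks_parts _ _ (by omega)) (mem_blocks_parts _ _ (by omega))
    le_rfl (by omega) (by rw [card_blocks_parts]; omega)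
  split_ifs <;> omega

/-- Witness `(m+1, m+1, m^{m-4}, m-2, m-2, 2) ⊢ m²` (`m = t + 4`). [cite: GesmundoIkenmeyerPanova2017, Prop. 19 (proof)] -/
theorem prop19_witness₃ (t a : ℕ) (ha : a + 4 = (t + 4) * (t + 4)) {ℓ : ℕ} (hℓ : t + 5 ≤ ℓ) :
    SmPos ℓ (twoTwoCol a) ∨ AmPos ℓ (twoTwoCol a) := by
  have hm : t * (t + 4) = t * t + 4 * t := by ring
  have hm' : (t + 4) * (t + 4) = t * t + 8 * t + 16 := by ring
  let nu : Nat.Partition (a + 4) :=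
    blocks 2 (t + 5) t (t + 4) 2 (t + 2) 1 2 0 1 (by omega) (by omega)
  refine smPos_or_amPos_twoTwoCol_of_mem nu (blocks_transpose_eq_self _ _ fun r => ?_)
    (p := t + 5) (q := 2) (mem_blocks_parts _ _ (by omega)) (mem_blocks_parts _ _ (by omega))
    (by omega) (by omega) (by rw [card_blocks_parts]; omega)
  split_ifs <;> omega

/-- Witness `((s+1)^h, s^{s-h}, h) ⊢ s² + 2h`, `2 ≤ h ≤ s - 1` (`h = u + 2`, `s = u + w + 3`).
[cite: GesmundoIkenmeyerPanova2017, Prop. 19 (proof)] -/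
theorem prop19_witness₄ (u w a : ℕ) (ha : a + 4 = (u + w + 3) * (u + w + 3) + 2 * (u + 2)) {ℓ : ℕ}
    (hℓ : u + w + 4 ≤ ℓ) : SmPos ℓ (twoTwoCol a) ∨ AmPos ℓ (twoTwoCol a) := by
  have hm : (u + 2) * (u + w + 4) = u * u + u * w + 6 * u + 2 * w + 8 := by ring
  have hm' : (w + 1) * (u + w + 3) = u * w + w * w + 4 * w + u + 3 := by ring
  have hm'' : (u + w + 3) * (u + w + 3) = u * u + 2 * (u * w) + w * w + 6 * u + 6 * w + 9 := by ring
  let nu : Nat.Partition (a + 4) :=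
    blocks (u + 2) (u + w + 4) (w + 1) (u + w + 3) 1 (u + 2) 0 1 0 1 (by omega) (by omega)
  refine smPos_or_amPos_twoTwoCol_of_mem nu (blocks_transpose_eq_self _ _ fun r => ?_)
    (p := u + w + 4) (q := u + 2) (mem_blocks_parts _ _ (by omega))
    (mem_blocks_parts _ _ (by omega)) (by omega) (by omega) (by rw [card_blocks_parts]; omega)
  split_ifs <;> omega

/-- Witness `(s+2, (s+1)^{s-2}, s, s-1, 1) ⊢ s² + 2s` (`s = t + 2`). [cite: GesmundoIkenmeyerPanova2017, Prop. 19 (proof)] -/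
theorem prop19_witness₅ (t a : ℕ) (ha : a + 4 = (t + 2) * (t + 2) + 2 * (t + 2)) {ℓ : ℕ}
    (hℓ : t + 4 ≤ ℓ) : SmPos ℓ (twoTwoCol a) ∨ AmPos ℓ (twoTwoCol a) := by
  have hm : t * (t + 3) = t * t + 3 * t := by ring
  have hm' : (t + 2) * (t + 2) = t * t + 4 * t + 4 := by ring
  let nu : Nat.Partition (a + 4) :=
    blocks 1 (t + 4) t (t + 3) 1 (t + 2) 1 (t + 1) 1 1 (by omega) (by omega)
  refine smPos_or_amPos_twoTwoCol_of_mem nu (blocks_transpose_eq_self _ _ fun r => ?_)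
    (p := t + 4) (q := 1) (mem_blocks_parts _ _ (by omega)) (mem_blocks_parts _ _ (by omega))
    le_rfl (by omega) (by rw [card_blocks_parts]; omega)
  split_ifs <;> omega

/-- Witness `((s+1)^j, s^k, s-1, j) ⊢ (s-1)² + 2(j + s - 1)`, `j + k = s - 1`, `j ≥ 2` (`j = u + 2`,
`k = w`, `s = u + w + 3`). [cite: GesmundoIkenmeyerPanova2017, Prop. 19 (proof)] -/
theorem prop19_witness₆ (u w a : ℕ)
    (ha : a + 4 = (u + w + 2) * (u + w + 2) + 2 * (2 * u + w + 4)) {ℓ : ℕ} (hℓ : u + w + 4 ≤ ℓ) :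
    SmPos ℓ (twoTwoCol a) ∨ AmPos ℓ (twoTwoCol a) := by
  have hm : (u + 2) * (u + w + 4) = u * u + u * w + 6 * u + 2 * w + 8 := by ring
  have hm' : w * (u + w + 3) = u * w + w * w + 3 * w := by ring
  have hm'' : (u + w + 2) * (u + w + 2) = u * u + 2 * (u * w) + w * w + 4 * u + 4 * w + 4 := by ring
  let nu : Nat.Partition (a + 4) :=
    blocks (u + 2) (u + w + 4) w (u + w + 3) 1 (u + w + 2) 1 (u + 2) 0 1 (by omega) (by omega)
  refine smPos_or_amPos_twoTwoCol_of_mem nu (blocks_transpose_eq_self _ _ fun r => ?_)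
    (p := u + w + 4) (q := u + 2) (mem_blocks_parts _ _ (by omega))
    (mem_blocks_parts _ _ (by omega)) (by omega) (by omega) (by rw [card_blocks_parts]; omega)
  split_ifs <;> omega

/-- Witness `(s+2, (s+1)^{s-2}, s-1, s-1, 1) ⊢ s² + 2s - 1` (`s = t + 2`). [cite: GesmundoIkenmeyerPanova2017, Prop. 19 (proof)] -/
theorem prop19_witness₇ (t a : ℕ) (ha : a + 4 + 1 = (t + 2) * (t + 2) + 2 * (t + 2)) {ℓ : ℕ}
    (hℓ : t + 4 ≤ ℓ) : SmPos ℓ (twoTwoCol a) ∨ AmPos ℓ (twoTwoCol a) := by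
  have hm : t * (t + 3) = t * t + 3 * t := by ring
  have hm' : (t + 2) * (t + 2) = t * t + 4 * t + 4 := by ring
  let nu : Nat.Partition (a + 4) :=
    blocks 1 (t + 4) t (t + 3) 2 (t + 1) 1 1 0 1 (by omega) (by omega)
  refine smPos_or_amPos_twoTwoCol_of_mem nu (blocks_transpose_eq_self _ _ fun r => ?_)
    (p := t + 4) (q := 1) (mem_blocks_parts _ _ (by omega)) (mem_blocks_parts _ _ (by omega))
    le_rfl (by omega) (by rw [card_blocks_parts]; omega)
  split_ifs <;> omega

/-- Witness `(5,1,1,1,1) ⊢ 9` (`a = 5`). [cite: GesmundoIkenmeyerPanova2017, Prop. 19 (proof)] -/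
theorem prop19_witness_nine {ℓ : ℕ} (hℓ : 5 ≤ ℓ) : SmPos ℓ (twoTwoCol 5) ∨ AmPos ℓ (twoTwoCol 5) := by
  let nu : Nat.Partition (5 + 4) := blocks 1 5 4 1 0 1 0 1 0 1 (by omega) (by omega)
  refine smPos_or_amPos_twoTwoCol_of_mem nu (blocks_transpose_eq_self _ _ fun r => ?_)
    (p := 5) (q := 1) (mem_blocks_parts _ _ (by omega)) (mem_blocks_parts _ _ (by omega))
    le_rfl (by omega) (by rw [card_blocks_parts]; omega)
  split_ifs <;> omega

/-- **GIP Prop. 19, corrected.** "We have that at least one of the two quantities is positive: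
`sm((2,2,1^a), ℓ) > 0` or `am((2,2,1^a), ℓ) > 0`", with `ℓ = max{7, ⌈√(a+2)⌉ + 1}` in place of the
printed `ℓ = max{7, ⌈√(a+2)⌉}` (`⌈√(a+2)⌉ = ⌊√(a+1)⌋ + 1`). The printed bound FAILS for `a = s² - 2`,
`s ≥ 7` (`a = 47, 62, 79, …`): then `λ = (2,2,1^a) ⊢ s² + 2` has `s²` parts, and for every
`μ ⊢ s² + 2` with `ℓ(μ) ≤ s`, `g(λ, μ, μ) = g((s², 2), μᵗ, μ) = 0` by the two-row rule
`g((n-2,2), μ, ν) = Σ_{α ⊢ n-2, β ⊢ 2} c^μ_{αβ} c^ν_{αβ} - #{α ⊢ n-1 : α ⊂ μ ∩ ν}` (a common `α ⊢ s²`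
inside `μ ∩ μᵗ ⊂ s × s` forces `μ ⊇ s^s`, `μ/s^s` a domino and `μᵗ/s^s` the transposed domino); so
`sm(λ, s) = am(λ, s) = 0` ((3.1)), e.g. `sm((2,2,1^{47}), 7) = am((2,2,1^{47}), 7) = 0`. The printed
proof takes "a self-conjugate partition of `a + 4` and length at most `ℓ`, as constructed in the
proof of Prop. 17", but a self-conjugate `μ ⊢ a + 4` with `ℓ(μ) ≤ s` needs `a + 4 ≤ s²`. With one
more row the printed argument goes through, and Prop. 20 only uses Prop. 19 with
`ℓ = max{⌈√L⌉ + 2, 12} ≥ ⌈√(a+2)⌉ + 2`. PROVED below (`GIP2017_prop19_corrected_holds`).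
[cite: GesmundoIkenmeyerPanova2017, Prop. 19] -/
def GIP2017_prop19_corrected : Prop :=
  ∀ a : ℕ, SmPos (max 7 (Nat.sqrt (a + 1) + 2)) (twoTwoCol a) ∨
    AmPos (max 7 (Nat.sqrt (a + 1) + 2)) (twoTwoCol a)

/-- **Proof of the corrected Prop. 19**, from the Kronecker semigroup and transposition properties
(both proved in the tree), `g((n), γ, γ) = 1`, and (3.1): for every `a` a self-conjugate
`ν ⊢ a + 4` with two rows differing by at least two and `ℓ(ν) ≤ max{7, ⌊√(a+1)⌋ + 2}` is exhibited
(seven explicit families indexed by `s = ⌊√(a+1)⌋` and the parity of `a + 4 - s²`, plus `(3,1)` for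
`a = 0` and `(5,1⁴)` for `a = 5`), and `g((2,2,1^a), ν, ν) = g((a+2,2), ν, ν) > 0`.
[cite: GesmundoIkenmeyerPanova2017, Prop. 19 (proof) and Prop. 37, Cor. 38] -/
theorem GIP2017_prop19_corrected_holds : GIP2017_prop19_corrected := by
  intro a
  set s := Nat.sqrt (a + 1) with hs
  have hs1 : s * s ≤ a + 1 := Nat.sqrt_le (a + 1)
  have hs2 : a + 1 < (s + 1) * (s + 1) := Nat.lt_succ_sqrt (a + 1)
  clear_value s
  have hsq : (s + 1) * (s + 1) = s * s + 2 * s + 1 := by ring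
  have hℓ : s + 2 ≤ max 7 (s + 2) := le_max_right _ _
  have h7 : 7 ≤ max 7 (s + 2) := le_max_left _ _
  obtain ⟨e, he⟩ : ∃ e, a + 4 = s * s + e := ⟨a + 4 - s * s, by omega⟩
  have hs0 : 1 ≤ s := by
    rw [Nat.one_le_iff_ne_zero]
    intro h0
    rw [h0] at hs2
    omega
  rcases Nat.even_or_odd' e with ⟨h, rfl | rfl⟩
  · -- `a + 4 = s² + 2h`, `2 ≤ h ≤ s + 1`
    rcases Nat.lt_or_ge h s with hlt | hge
    · -- `2 ≤ h ≤ s - 1`: witness 4 with `u = h - 2`, `w = s - 1 - h`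
      obtain ⟨u, rfl⟩ : ∃ u, h = u + 2 := ⟨h - 2, by omega⟩
      obtain ⟨w, hw⟩ : ∃ w, s = u + w + 3 := ⟨s - u - 3, by omega⟩
      refine prop19_witness₄ u w a ?_ (by omega)
      rw [he, hw]
    · rcases Nat.lt_or_ge s h with hlt' | hge'
      · -- `h = s + 1`: `a + 4 = (s+1)² + 1`, witness 2 with `t = s - 1`
        obtain ⟨t, rfl⟩ : ∃ t, s = t + 1 := ⟨s - 1, by omega⟩
        refine prop19_witness₂ t a ?_ (by omega)
        have : h = t + 2 := by omega
        rw [he, this]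
        ring
      · -- `h = s`: `a + 4 = s² + 2s`, witness 5 with `t = s - 2`
        have hh : h = s := le_antisymm hge' hge
        obtain ⟨t, rfl⟩ : ∃ t, s = t + 2 := ⟨s - 2, by omega⟩
        refine prop19_witness₅ t a ?_ (by omega)
        rw [he, hh]
  · -- `a + 4 = s² + 2h + 1`, `1 ≤ h ≤ s + 1`
    rcases Nat.lt_or_ge (h + 1) s with hlt | hge
    · -- `1 ≤ h ≤ s - 2`: witness 6 with `u = h - 1`, `w = s - 2 - h`
      obtain ⟨u, rfl⟩ : ∃ u, h = u + 1 := ⟨h - 1, by omega⟩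
      obtain ⟨w, hw⟩ : ∃ w, s = u + w + 3 := ⟨s - u - 3, by omega⟩
      refine prop19_witness₆ u w a ?_ (by omega)
      rw [he, hw]
      ring
    · rcases Nat.lt_or_ge s (h + 1) with hlt' | hge'
      · rcases Nat.lt_or_ge s h with hlt'' | hge''
        · -- `h = s + 1`: `a + 4 = (s+1)² + 2`, witness 1 with `t = s - 1`
          obtain ⟨t, rfl⟩ : ∃ t, s = t + 1 := ⟨s - 1, by omega⟩
          refine prop19_witness₁ t a ?_ (by omega)
          have : h = t + 2 := by omega
          rw [he, this]
          ring
        · -- `h = s`: `a + 4 = (s+1)²`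
          have hh : h = s := by omega
          rcases Nat.lt_or_ge s 3 with hs3 | hs3
          · interval_cases s
            · -- `a = 0`
              have ha : a = 0 := by omega
              subst ha
              exact smPos_or_amPos_twoTwoCol_zero (by omega)
            · -- `a = 5`
              have ha : a = 5 := by omega
              subst ha
              exact prop19_witness_nine (by omega)
          · obtain ⟨t, rfl⟩ : ∃ t, s = t + 3 := ⟨s - 3, by omega⟩
            refine prop19_witness₃ t a ?_ (by omega)
            rw [he, hh]
            ring
      · -- `h = s - 1`: `a + 4 = s² + 2s - 1`, witness 7 with `t = s - 2`
        have hh : h + 1 = s := le_antisymm hge' hge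
        obtain ⟨t, rfl⟩ : ∃ t, s = t + 2 := ⟨s - 2, by omega⟩
        refine prop19_witness₇ t a ?_ (by omega)
        have : h = t + 1 := by omega
        rw [he, this]
        ring

end Prop19

end Literature.Barriers.ValiantsHypothesis

end
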